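import Summits.NavierStokesRegularity.FluidComputer.HalfOctaveWindow
import Mathlib.Analysis.SpecialFunctions.Log.Deriv
import HarnessLib

/-!
# The declared window `lp-c2-halfoctave/v1` at the zero mode (documented junk value + guarded variant)

Cell `pub-fluidc`, prover seat p1; companion to `FluidComputer.HalfOctaveWindow`. HONEST FRAMING: low prior, high
value-of-information experiment on Tao's machine paradigm; NOT a claim that NS blows up.

`HalfOctaveWindow.window a b s = S(2 log₂(s/a) + 1) · S(2 log₂(b/s) + 1)` is the bare formula on ALL of `ℝ`, and
every statement of that file is about moduli `s > 0`. Because Mathlib's `Real.logb` is even and sends `0` to `0`,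
the bare formula is EVEN in `s` (`window_neg`) and takes the JUNK VALUE `1` at `s = 0` (`window_zero`): read
literally at the zero lattice mode it would weight the mean flow fully. The cell's implementation (`r3fwd.py ≥ 0.1.1`)
floors `log₂ 0`, i.e. gives the zero mode weight `0` (and the fields it reads have zero mean anyway). This file
records both facts and the guarded variant `windowMod a b s = if 0 < s then window a b s else 0`, which IS the
implemented multiplier as a function of the modulus, with the indicator sandwich now valid on all of `ℝ`
(`indicator_le_windowMod`, `windowMod_le_indicator`) and the same plateau / support / dilation statements.

0 sorry; axioms ⊆ {propext, Classical.choice, Quot.sound}; no named fact introduced.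
-/

noncomputable section

namespace Summit.NavierStokesRegularity.FluidComputer.HalfOctaveWindow

open Real Set

variable {a b c s : ℝ}

/-- The bare formula is even in the modulus variable: `φ_{a,b}(-s) = φ_{a,b}(s)` (`Real.logb` is even). -/
theorem window_neg (a b s : ℝ) : window a b (-s) = window a b s := by
  unfold window
  rw [neg_div, div_neg, logb_neg_eq_logb, logb_neg_eq_logb]

/-- JUNK VALUE: the bare formula gives `φ_{a,b}(0) = 1` (`Real.logb 2 0 = 0`, `b / 0 = 0`). The implementation gives
the zero mode weight `0` instead; see `windowMod`. -/
theorem window_zero (a b : ℝ) : window a b 0 = 1 := by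
  unfold window
  rw [zero_div, div_zero, logb_zero]
  norm_num [smootherstep_of_one_le]

/-- The guarded window = the implemented multiplier as a function of the modulus: the bare formula on `s > 0`,
weight `0` at `s ≤ 0` (in particular at the zero mode). -/
def windowMod (a b s : ℝ) : ℝ := if 0 < s then window a b s else 0

/-- On `s > 0` the guarded window is the declared formula. -/
theorem windowMod_of_pos (hs : 0 < s) : windowMod a b s = window a b s := if_pos hs

/-- On `s ≤ 0` the guarded window vanishes. -/
theorem windowMod_of_nonpos (hs : s ≤ 0) : windowMod a b s = 0 := if_neg (not_lt.2 hs)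

/-- The zero mode carries no weight. -/
theorem windowMod_zero (a b : ℝ) : windowMod a b 0 = 0 := windowMod_of_nonpos le_rfl

/-- `0 ≤ windowMod ≤ 1`. -/
theorem windowMod_mem_Icc (a b s : ℝ) : windowMod a b s ∈ Icc (0:ℝ) 1 := by
  unfold windowMod; split_ifs
  exacts [⟨window_nonneg a b s, window_le_one a b s⟩, ⟨le_rfl, zero_le_one⟩]

/-- PLATEAU: `windowMod = 1` on the closed band `[a, b]` (`0 < a`). -/
theorem windowMod_eq_one (ha : 0 < a) (has : a ≤ s) (hsb : s ≤ b) : windowMod a b s = 1 := by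
  rw [windowMod_of_pos (ha.trans_le has), window_eq_one ha has hsb]

/-- SUPPORT, lower side, now without a sign hypothesis: `windowMod = 0` for `s ≤ a/√2` (`0 < a`). -/
theorem windowMod_eq_zero_of_le (ha : 0 < a) (hsa : s ≤ a / Real.sqrt 2) : windowMod a b s = 0 := by
  rcases le_or_gt s 0 with hs | hs
  · exact windowMod_of_nonpos hs
  · rw [windowMod_of_pos hs, window_eq_zero_of_le ha hs hsa]

/-- SUPPORT, upper side: `windowMod = 0` for `b √2 ≤ s` (`0 < b`). -/
theorem windowMod_eq_zero_of_ge (hb : 0 < b) (hbs : b * Real.sqrt 2 ≤ s) : windowMod a b s = 0 := by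
  have hs : 0 < s := lt_of_lt_of_le (mul_pos hb (Real.sqrt_pos.2 two_pos)) hbs
  rw [windowMod_of_pos hs, window_eq_zero_of_ge hb hbs]

/-- Sandwich, lower half, on all of `ℝ`: `1_{[a,b]} ≤ windowMod` (`0 < a`). -/
theorem indicator_le_windowMod (ha : 0 < a) (s : ℝ) :
    (Icc a b).indicator (fun _ => (1:ℝ)) s ≤ windowMod a b s := by
  by_cases h : s ∈ Icc a b
  · rw [indicator_of_mem h, windowMod_eq_one ha h.1 h.2]
  · rw [indicator_of_notMem h]; exact (windowMod_mem_Icc a b s).1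

/-- Sandwich, upper half, on all of `ℝ`: `windowMod ≤ 1_{(a/√2, b√2)}` (`0 < a`, `0 < b`). -/
theorem windowMod_le_indicator (ha : 0 < a) (hb : 0 < b) (s : ℝ) :
    windowMod a b s ≤ (Ioo (a / Real.sqrt 2) (b * Real.sqrt 2)).indicator (fun _ => (1:ℝ)) s := by
  by_cases h : s ∈ Ioo (a / Real.sqrt 2) (b * Real.sqrt 2)
  · rw [indicator_of_mem h]; exact (windowMod_mem_Icc a b s).2
  · rw [indicator_of_notMem h]
    simp only [mem_Ioo, not_and_or, not_lt] at h
    rcases h with h | h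
    · exact (windowMod_eq_zero_of_le ha h).le
    · exact (windowMod_eq_zero_of_ge hb h).le

/-- LEVEL INDEPENDENCE of the guarded window: `windowMod (ca) (cb) (cs) = windowMod a b s` for `c > 0`. -/
theorem windowMod_dilate (hc : 0 < c) (a b s : ℝ) :
    windowMod (c * a) (c * b) (c * s) = windowMod a b s := by
  rcases le_or_gt s 0 with hs | hs
  · rw [windowMod_of_nonpos (mul_nonpos_of_nonneg_of_nonpos hc.le hs), windowMod_of_nonpos hs]
  · rw [windowMod_of_pos (mul_pos hc hs), windowMod_of_pos hs, window_dilate hc.ne' a b s]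

/-! ## The window is `C²` in the modulus on `(0, ∞)` (appended 2026-08-23, p1 gen 4)

`HalfOctaveWindow.contDiff_two_smootherstep` is the `C²` statement for the PROFILE `S`; composed with the smooth maps
`s ↦ 2 log₂(s/a) + 1`, `s ↦ 2 log₂(b/s) + 1` on `s > 0` it gives the `C²` statement for the window itself as a
function of the wavenumber modulus — the sense in which the family name says `c2`. -/

/-- `log₂` is smooth (here: `C²`) on `(0, ∞)`. -/
theorem contDiffOn_logb_Ioi : ContDiffOn ℝ 2 (fun s : ℝ => logb 2 s) (Ioi 0) := by
  have h : ContDiffOn ℝ 2 Real.log (Ioi 0) :=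
    (Real.contDiffOn_log.of_le le_top).mono fun x hx => ne_of_gt hx
  simpa [Real.logb, div_eq_mul_inv] using h.mul contDiffOn_const

/-- The bare window formula is `C²` on `(0, ∞)` (`0 < a`, `0 < b`). -/
theorem contDiffOn_window (ha : 0 < a) (hb : 0 < b) : ContDiffOn ℝ 2 (window a b) (Ioi 0) := by
  unfold window
  have hS : ContDiff ℝ 2 smootherstep := contDiff_two_smootherstep
  have h1 : ContDiffOn ℝ 2 (fun s : ℝ => 2 * logb 2 (s / a) + 1) (Ioi 0) := by
    have : ContDiffOn ℝ 2 (fun s : ℝ => logb 2 (s / a)) (Ioi 0) :=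
      contDiffOn_logb_Ioi.comp (contDiffOn_id.div_const a) fun s hs => div_pos hs ha
    exact (contDiffOn_const.mul this).add contDiffOn_const
  have h2 : ContDiffOn ℝ 2 (fun s : ℝ => 2 * logb 2 (b / s) + 1) (Ioi 0) := by
    have : ContDiffOn ℝ 2 (fun s : ℝ => logb 2 (b / s)) (Ioi 0) :=
      contDiffOn_logb_Ioi.comp (contDiffOn_const.div contDiffOn_id fun s hs => ne_of_gt hs)
        fun s hs => div_pos hb hs
    exact (contDiffOn_const.mul this).add contDiffOn_const
  exact (hS.comp_contDiffOn h1).mul (hS.comp_contDiffOn h2)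

/-- The guarded window (= the implemented multiplier) is `C²` on `(0, ∞)` as well (`0 < a`, `0 < b`). -/
theorem contDiffOn_windowMod (ha : 0 < a) (hb : 0 < b) : ContDiffOn ℝ 2 (windowMod a b) (Ioi 0) :=
  (contDiffOn_window ha hb).congr fun _ hs => windowMod_of_pos hs

end Summit.NavierStokesRegularity.FluidComputer.HalfOctaveWindow

end
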